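import Summits.CriticalPhenomena.PercolationContinuityZ3.Theorems.PercNearOneGluingNoHeavyLowerTailSahiCombVennThree

/-!
# The comb (tensor-Bernstein) hierarchy for Sahi's `E_k`: (M⁺-3) — Kahn's Conjecture 5 at the comb level — for the CO-SUNFLOWER of
# every triple of PRINCIPAL up-sets / of INTERSECTIONS OF INDEPENDENT EVENTS, from ONE kernel certificate on seven coins

Support file (crux `NoHeavyLowerTail`, stmt-CriticalPhenomena-4575; cell `prim-masterthm`, seat P1, gen 21; memo
`run/shared/lean/prim/prim-masterthm/FROM-prim-masterthm-p1-g21-PRODUCT-FORM.md` §2).  Vocabulary and engine are seat P3's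
(`…SahiCombVennThree`: `encA_eq_ofBits`, the masks `85, 102, 120` of the Venn codes containing `0, 1, 2`; `SahiC3Cube.checkTriple` = prim-sahi's
three-copy digit certificate; `SahiC3CombCube.combPos_sahiE_three_of_checkTriple`; the read-once substitution theorem `SahiCombReadOnce.CombPos.readOnce`).

THE POINT.  The co-sunflower class law of the seat-P1 programme (Sahi's `C₃` / Kahn's Conjecture 5 for the sandwiched triple
`(G₁∪G₂, G₀∪G₂, G₀∪G₁)` of three increasing events; OPEN in general) for the class of PRINCIPAL generators `G_k = ↑b_k = {ω ⊇ b_k}`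
(`b₀, b₁, b₂ ⊆ ι` ARBITRARY, overlaps allowed) is a read-once substitution instance of ONE triple on the seven-point cube: with the Venn regions
`R_T = {i | {k | i ∈ b_k} = T}` (`∅ ≠ T ⊆ {0,1,2}`) and the independent AND-gadgets `g_T = {ω ⊇ R_T}`, `↑b_k = ⋂_{T ∋ k} g_T`, so
`G_j ∪ G_l = {ω | {T | ω ∈ g_T} ∈ base_k}` for the base event `base_k = {ξ ⊆ 7 | ∃ j ≠ k, ξ ⊇ S_j}`, `S_j = {T ∋ j}`.  The digit certificate
of `(base_0, base_1, base_2)` passes in the kernel (`decide`, ≈ 8 s: all `4^7` three-copy fibre sums of `E_3` are `≥ 0`), so: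
* `certs_coBase`, `combPos_sahiE_three_coBase` — (M⁺-3) for the base triple on `Fin 7` (no new definition: the base is inlined);
* **`combPos_sahiE_three_coVenn`** — (M⁺-3) for `(⋃_{j≠k} ⋂_{T ∋ j} G_T)_k` for any seven gadgets `G r` determined by the fibres of any `π : ι → Fin 7`;
* **`combPos_sahiE_three_coSunflower_inters`** — for every finite family `(H_a)` of events with pairwise disjoint determining sets (independent under
  every product measure; no monotonicity needed) and all `A_0, A_1, A_2`: with `G_k = ⋂_{A_k} H`, the co-sunflower `(⋃_{j ≠ k} G_j)_k` satisfies (M⁺-3);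
  law-level shadow `sahiE_three_nonneg_coSunflower_inters`;
* **`combPos_sahiE_three_principal`**, **`sahiE3_nonneg_principal_coSunflower`** — for all `b₀, b₁, b₂ : Finset ι` and every product measure,
  `sahiE3 (prodBernoulli q) (↑b₁ ∪ ↑b₂) (↑b₀ ∪ ↑b₂) (↑b₀ ∪ ↑b₁) ≥ 0` (Sahi `E_3 ≥ 0` / Kahn C5 on the principal co-sunflower class).
Companion facts (memo §2, exact integer checks outside the kernel): the base is a MIXED system with CP3⁺ at all `4^7` vertex fibres (⇒ S₃⁺
for the whole class via the gen-20 vertex principle) and `e₃/(max(κ,o)G) ≤ 0.08` on a bias sample.  This is the AND-dual companion of P3's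
`combPos_sahiE_three_unions` (triples of UNIONS of independent events); here the members are unions of two INTERSECTIONS.
HONEST FRAMING: one new proved stratum of the class law; nothing here asserts (M⁺-3) or `C_3` in general. [this work]
-/

noncomputable section

namespace Summit.CriticalPhenomena.PercolationContinuityZ3.Theorems

open Finset Function MeasureTheory
open Literature.Combinatorics.Sahi2008
open Literature.Probability.LatticeModels (prodBernoulli sahiE3)
open Literature.Probability.Percolation (DeterminedBy determinedBy_iff determinedBy_univ)
open Literature.Probability.Percolation.DecisionTree (ind ind_of_mem ind_of_not_mem ind_nonneg)
open SahiComb SahiCombTensor SahiCombReadOnce SahiC3Cube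

namespace SahiCombVenn

/-! ### The base triple on the seven-point cube and its certificate -/

/-! The PRINCIPAL CO-SUNFLOWER BASE (no new definition, everything inlined): member `k` is
`{ξ ⊆ 7 | ∃ j ≠ k, ∀ r, j ∈ code(r+1) → r ∈ ξ}` — the union of the two principal up-sets `↑S_j` (`S_j = {r | j ∈ code(r+1)}`, `j ≠ k`)
of the seven-point cube; as a mask test on the bitmask `x` of a point: `∃ j ≠ k, x &&& M_j = M_j` with `M = (85, 102, 120)`. -/

/-- **The seven-coin certificate** (kernel `decide`): the three-copy digit test of the base triple passes — every tensor-Bernstein coefficient of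
`q ↦ E_3(μ_q; 1_{base_0}, 1_{base_1}, 1_{base_2})` at multidegree `3` is nonnegative. [this work] -/
theorem certs_coBase :
    checkTriple 26 7 (ofBits (fun x => decide (∃ j : Fin 3, j ≠ (0 : Fin 3) ∧ x &&& (![85, 102, 120] j) = ![85, 102, 120] j)) (2 ^ 7))
      (ofBits (fun x => decide (∃ j : Fin 3, j ≠ (1 : Fin 3) ∧ x &&& (![85, 102, 120] j) = ![85, 102, 120] j)) (2 ^ 7))
      (ofBits (fun x => decide (∃ j : Fin 3, j ≠ (2 : Fin 3) ∧ x &&& (![85, 102, 120] j) = ![85, 102, 120] j)) (2 ^ 7)) = true := by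
  decide +kernel

/-- Membership in the base events as the mask test (kernel `decide`). [this work] -/
theorem coBase_mem : ∀ (k : Fin 3) (x : ℕ), x < 2 ^ 7 →
    ((∃ j : Fin 3, j ≠ k ∧ ∀ r : Fin 7, (r.1 + 1).testBit j = true → x.testBit r = true) ↔
      decide (∃ j : Fin 3, j ≠ k ∧ x &&& (![85, 102, 120] j) = ![85, 102, 120] j) = true) := by
  decide

/-- The base events have the announced bitmasks. [this work] -/
theorem encA_coBase (k : Fin 3) :
    encA 7 {ξ : Set (Fin 7) | ∃ j : Fin 3, j ≠ k ∧ ∀ r : Fin 7, (r.1 + 1).testBit j = true → r ∈ ξ} =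
      ofBits (fun x => decide (∃ j : Fin 3, j ≠ k ∧ x &&& (![85, 102, 120] j) = ![85, 102, 120] j)) (2 ^ 7) := by
  refine encA_eq_ofBits _ fun x hx => ?_
  simpa only [Set.mem_setOf_eq, pt] using coBase_mem k x hx

/-- The certificate in event form. [this work] -/
theorem certs_coBase_encA :
    checkTriple 26 7 (encA 7 {ξ : Set (Fin 7) | ∃ j : Fin 3, j ≠ (0 : Fin 3) ∧ ∀ r : Fin 7, (r.1 + 1).testBit j = true → r ∈ ξ})
      (encA 7 {ξ : Set (Fin 7) | ∃ j : Fin 3, j ≠ (1 : Fin 3) ∧ ∀ r : Fin 7, (r.1 + 1).testBit j = true → r ∈ ξ})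
      (encA 7 {ξ : Set (Fin 7) | ∃ j : Fin 3, j ≠ (2 : Fin 3) ∧ ∀ r : Fin 7, (r.1 + 1).testBit j = true → r ∈ ξ}) = true := by
  rw [encA_coBase, encA_coBase, encA_coBase]
  exact certs_coBase

/-- **(M⁺-3) for the base triple on `{0,1}^7`.** [this work] -/
theorem combPos_sahiE_three_coBase :
    CombPos (fun _ : Fin 7 => 3) (fun p => sahiE (bernoulliWeight p) 3 (fun k => ind
      {ξ : Set (Fin 7) | ∃ j : Fin 3, j ≠ k ∧ ∀ r : Fin 7, (r.1 + 1).testBit j = true → r ∈ ξ})) := by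
  refine (SahiC3CombCube.combPos_sahiE_three_of_checkTriple certs_coBase_encA).congr fun p => ?_
  congr 1; funext k; fin_cases k <;> rfl

/-! ### Read-once transfer -/

variable {ι : Type} [Fintype ι]

omit [Fintype ι] in
/-- Substituting gadgets into the base member `k` gives the union over `j ≠ k` of the intersections of the gadgets whose code contains `j`. [this work] -/
theorem readOnce_coBase (G : Fin 7 → Set (Set ι)) (k : Fin 3) :
    {ω : Set ι | {r | ω ∈ G r} ∈ {ξ : Set (Fin 7) | ∃ j : Fin 3, j ≠ k ∧ ∀ r : Fin 7, (r.1 + 1).testBit j = true → r ∈ ξ}} =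
      ⋃ (j : Fin 3) (_ : j ≠ k), ⋂ (r : Fin 7) (_ : (r.1 + 1).testBit j = true), G r := by
  ext ω
  simp only [Set.mem_setOf_eq, Set.mem_iUnion, Set.mem_iInter, exists_prop]

/-- **(M⁺-3) for the co-Venn pattern of independent gadgets.**  For gadgets `G r` (`r : Fin 7`) determined by the fibres of `π : ι → Fin 7`, the triple
whose member `k` is `⋃_{j ≠ k} ⋂_{r : j ∈ code(r+1)} G r` has `E_3` comb-positive at multidegree `3`. [this work] -/
theorem combPos_sahiE_three_coVenn (π : ι → Fin 7) (G : Fin 7 → Set (Set ι)) (hG : ∀ r, DeterminedBy (G r) {i | π i = r}) :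
    CombPos (fun _ : ι => 3) (fun q => sahiE (bernoulliWeight q) 3 (fun k => ind
      (⋃ (j : Fin 3) (_ : j ≠ k), ⋂ (r : Fin 7) (_ : (r.1 + 1).testBit j = true), G r))) := by
  refine (CombPos.readOnce π G hG combPos_sahiE_three_coBase).congr fun q => ?_
  congr 1; funext k; rw [readOnce_coBase]

/-! ### Co-sunflowers of intersections of an arbitrary independent family -/

section Inters

variable {A : Type} [Fintype A]

/-- **(M⁺-3) FOR CO-SUNFLOWERS OF INTERSECTIONS OF INDEPENDENT EVENTS.**  Let `(H_a)_{a ∈ A}` be events of a finite cube determined by pairwise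
disjoint coordinate sets `D_a` (independent under every product measure; no monotonicity needed), `A_0, A_1, A_2 ⊆ A` arbitrary, and
`G_k = ⋂_{a ∈ A_k} H_a`.  Then `q ↦ E_3(μ_q; 1_{G_1 ∪ G_2}, 1_{G_0 ∪ G_2}, 1_{G_0 ∪ G_1})` is a nonnegative combination of the degree-3 tensor-Bernstein basis
on `[0,1]^ι` (Kahn's Conjecture 5 at the comb level for the co-sunflower of this class). [this work] -/
theorem combPos_sahiE_three_coSunflower_inters (H : A → Set (Set ι)) (D : A → Finset ι)
    (hD : ∀ a b, a ≠ b → Disjoint (D a) (D b)) (hH : ∀ a, DeterminedBy (H a) (↑(D a) : Set ι)) (𝒜 : Fin 3 → Finset A) :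
    CombPos (fun _ : ι => 3) (fun q => sahiE (bernoulliWeight q) 3
      (fun k => ind (⋃ (j : Fin 3) (_ : j ≠ k), ⋂ a ∈ 𝒜 j, H a))) := by
  classical
  -- Venn codes, the projection `π` and the seven gadgets (as in `combPos_sahiE_three_unions`, with intersections)
  let code : A → ℕ := fun a => (if a ∈ 𝒜 0 then 1 else 0) + (if a ∈ 𝒜 1 then 2 else 0) + (if a ∈ 𝒜 2 then 4 else 0)
  have hcode7 : ∀ a, code a ≤ 7 := fun a => code_le 𝒜 a
  have hbit : ∀ a (k : Fin 3), (code a).testBit k = true ↔ a ∈ 𝒜 k := fun a k => testBit_code 𝒜 a k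
  let π : ι → Fin 7 := fun i =>
    if h : ∃ a, i ∈ D a ∧ code a ≠ 0 then ⟨code h.choose - 1, by have := hcode7 h.choose; omega⟩ else 0
  let G : Fin 7 → Set (Set ι) := fun r => ⋂ (a : A) (_ : code a = r.1 + 1), H a
  have howner : ∀ {i a}, i ∈ D a → code a ≠ 0 → π i = ⟨code a - 1, by have := hcode7 a; omega⟩ := by
    intro i a hi hca
    have hex : ∃ a, i ∈ D a ∧ code a ≠ 0 := ⟨a, hi, hca⟩
    have hπ : π i = ⟨code hex.choose - 1, by have := hcode7 hex.choose; omega⟩ := dif_pos hex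
    have ha : hex.choose = a := by
      by_contra hne
      exact Finset.disjoint_left.1 (hD _ _ hne) hex.choose_spec.1 hi
    rw [hπ]; exact Fin.ext (by simp only [ha])
  have hG : ∀ r, DeterminedBy (G r) {i | π i = r} := by
    intro r
    rw [determinedBy_iff]
    intro ω ω' hωω'
    simp only [G, Set.mem_iInter]
    refine forall_congr' fun a => forall_congr' fun hca => ?_
    refine (determinedBy_iff _ _).1 (hH a) ω ω' ?_
    have hsub : (↑(D a) : Set ι) ⊆ {i | π i = r} := fun i hi => by
      have hca0 : code a ≠ 0 := by omega
      simp only [Set.mem_setOf_eq, howner (Finset.mem_coe.1 hi) hca0]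
      exact Fin.ext (by simp only [hca]; omega)
    rw [← Set.inter_eq_self_of_subset_right hsub, ← Set.inter_assoc, ← Set.inter_assoc, hωω']
  have h := combPos_sahiE_three_coVenn π G hG
  refine h.congr fun q => ?_
  congr 1; funext k; congr 1
  refine Set.iUnion_congr fun j => Set.iUnion_congr fun _ => ?_
  ext ω
  simp only [G, Set.mem_iInter]
  constructor
  · intro hω r hr a hca
    exact hω a ((hbit a j).1 (by rw [hca]; exact hr))
  · intro hω a ha
    have hca : (code a).testBit j = true := (hbit a j).2 ha
    have hca0 : code a ≠ 0 := fun h0 => by rw [h0] at hca; simp at hca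
    have e : code a - 1 + 1 = code a := by omega
    have hr : ((⟨code a - 1, by have := hcode7 a; omega⟩ : Fin 7).1 + 1).testBit j = true := by
      show (code a - 1 + 1).testBit j = true
      rw [e]; exact hca
    exact hω ⟨code a - 1, by have := hcode7 a; omega⟩ hr a (by show code a = code a - 1 + 1; omega)

/-- Law-level shadow: `E_3(μ_q; 1_{G_1∪G_2}, 1_{G_0∪G_2}, 1_{G_0∪G_1}) ≥ 0` for `G_k = ⋂_{A_k} H` and every product measure. [this work] -/
theorem sahiE_three_nonneg_coSunflower_inters (q : ι → unitInterval) (H : A → Set (Set ι)) (D : A → Finset ι)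
    (hD : ∀ a b, a ≠ b → Disjoint (D a) (D b)) (hH : ∀ a, DeterminedBy (H a) (↑(D a) : Set ι)) (𝒜 : Fin 3 → Finset A) :
    0 ≤ sahiE (bernoulliWeight q) 3 (fun k => ind (⋃ (j : Fin 3) (_ : j ≠ k), ⋂ a ∈ 𝒜 j, H a)) :=
  (combPos_sahiE_three_coSunflower_inters H D hD hH 𝒜).nonneg q

end Inters

/-! ### Principal up-sets -/

/-- **(M⁺-3) FOR THE CO-SUNFLOWER OF THREE PRINCIPAL UP-SETS**: for all `b_0, b_1, b_2 ⊆ ι` (arbitrary overlaps),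
`q ↦ E_3(μ_q; 1_{↑b_1 ∪ ↑b_2}, 1_{↑b_0 ∪ ↑b_2}, 1_{↑b_0 ∪ ↑b_1})` is comb-positive at multidegree `3`, `↑b = {ω | b ⊆ ω}`. [this work] -/
theorem combPos_sahiE_three_principal (b : Fin 3 → Finset ι) :
    CombPos (fun _ : ι => 3) (fun q => sahiE (bernoulliWeight q) 3
      (fun k => ind (⋃ (j : Fin 3) (_ : j ≠ k), {ω : Set ι | (↑(b j) : Set ι) ⊆ ω}))) := by
  classical
  have h := combPos_sahiE_three_coSunflower_inters (A := ι) (fun i => {ω : Set ι | i ∈ ω}) (fun i => {i})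
    (fun a c hac => Finset.disjoint_singleton.2 hac) (fun i => (determinedBy_iff _ _).2 fun ω ω' hωω' => ?_) b
  · refine h.congr fun q => ?_
    congr 1; funext k; congr 1
    refine Set.iUnion_congr fun j => Set.iUnion_congr fun _ => ?_
    ext ω
    simp only [Set.mem_iInter, Set.mem_setOf_eq, Set.subset_def, Finset.mem_coe]
  · have h1 := Set.ext_iff.1 hωω' i
    simp only [Finset.coe_singleton, Set.mem_inter_iff, Set.mem_singleton_iff, and_true, Set.mem_setOf_eq] at h1 ⊢
    exact h1

/-- Law-level shadow (functional form). [this work] -/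
theorem sahiE_three_nonneg_principal (q : ι → unitInterval) (b : Fin 3 → Finset ι) :
    0 ≤ sahiE (bernoulliWeight q) 3 (fun k => ind (⋃ (j : Fin 3) (_ : j ≠ k), {ω : Set ι | (↑(b j) : Set ι) ⊆ ω})) :=
  (combPos_sahiE_three_principal b).nonneg q

omit [Fintype ι] in
/-- The three members, written out. [this work] -/
theorem coSunflower_members (X : Fin 3 → Set (Set ι)) :
    (fun k : Fin 3 => ind (⋃ (j : Fin 3) (_ : j ≠ k), X j)) = ![ind (X 1 ∪ X 2), ind (X 0 ∪ X 2), ind (X 0 ∪ X 1)] := by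
  have e : ∀ k : Fin 3, (⋃ (j : Fin 3) (_ : j ≠ k), X j) = (![X 1 ∪ X 2, X 0 ∪ X 2, X 0 ∪ X 1] k) := by
    intro k
    ext ω
    simp only [Set.mem_iUnion, exists_prop, Fin.exists_fin_succ, Fin.exists_fin_zero, or_false]
    fin_cases k <;> simp
  funext k
  rw [e k]
  fin_cases k <;> rfl

/-- **Sahi's `E_3 ≥ 0` (Kahn's Conjecture 5 instance) for the co-sunflower of three principal up-sets**, event form: for all finite
`b₀, b₁, b₂ ⊆ ι` and every product measure, `sahiE3 (prodBernoulli q) (↑b₁ ∪ ↑b₂) (↑b₀ ∪ ↑b₂) (↑b₀ ∪ ↑b₁) ≥ 0`. [this work] -/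
theorem sahiE3_nonneg_principal_coSunflower (q : ι → unitInterval) (b₀ b₁ b₂ : Finset ι) :
    0 ≤ sahiE3 (prodBernoulli q)
      ({ω : Set ι | (↑b₁ : Set ι) ⊆ ω} ∪ {ω | (↑b₂ : Set ι) ⊆ ω})
      ({ω : Set ι | (↑b₀ : Set ι) ⊆ ω} ∪ {ω | (↑b₂ : Set ι) ⊆ ω})
      ({ω : Set ι | (↑b₀ : Set ι) ⊆ ω} ∪ {ω | (↑b₁ : Set ι) ⊆ ω}) := by
  have h := sahiE_three_nonneg_principal q ![b₀, b₁, b₂]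
  rw [coSunflower_members (fun j => {ω : Set ι | (↑((![b₀, b₁, b₂] : Fin 3 → Finset ι) j) : Set ι) ⊆ ω}), sahiE_three_ind] at h
  exact h

/-- **The same for intersections of independent events**, event form: `H_a` with pairwise disjoint determining sets, `G_k = ⋂_{A_k} H`:
`sahiE3 (prodBernoulli q) (G₁ ∪ G₂) (G₀ ∪ G₂) (G₀ ∪ G₁) ≥ 0`. [this work] -/
theorem sahiE3_nonneg_coSunflower_inters {A : Type} [Fintype A] (q : ι → unitInterval) (H : A → Set (Set ι)) (D : A → Finset ι)
    (hD : ∀ a b, a ≠ b → Disjoint (D a) (D b)) (hH : ∀ a, DeterminedBy (H a) (↑(D a) : Set ι)) (A₀ A₁ A₂ : Finset A) :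
    0 ≤ sahiE3 (prodBernoulli q)
      ((⋂ a ∈ A₁, H a) ∪ (⋂ a ∈ A₂, H a)) ((⋂ a ∈ A₀, H a) ∪ (⋂ a ∈ A₂, H a)) ((⋂ a ∈ A₀, H a) ∪ (⋂ a ∈ A₁, H a)) := by
  have h := sahiE_three_nonneg_coSunflower_inters q H D hD hH ![A₀, A₁, A₂]
  rw [coSunflower_members (fun j => ⋂ a ∈ (![A₀, A₁, A₂] : Fin 3 → Finset A) j, H a), sahiE_three_ind] at h
  exact h

end SahiCombVenn

end Summit.CriticalPhenomena.PercolationContinuityZ3.Theorems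

end
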